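import Summits.QuantumFields.QCD.Theorems.WilsonMobilityGapMobilityGapWilsonPointwiseCoercive
import Literature.Barriers.QuantumFields.WilsonDeterminantSign
import Literature.Analysis.Matrix.CoerciveCombesThomas
import Literature.MathematicalPhysics.QuantumLattice.WilsonDiracRangeOne
import Literature.MathematicalPhysics.QuantumLattice.MobilityGap
import Literature.MathematicalPhysics.QuantumFieldTheory.QCDPhaseQuenched

/-!
# The trivial valence plateau of the Hermitian Wilson–Dirac kernel
# (fragment for crux `MobilityGap`, stmt-QuantumFields-9150, line `Ideator6Sketch`, stub `stub_valencePinch`)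

**Configuration-wise.**  For every residual gap `g > 0`, every four-torus `(ℤ/L)⁴`, every `SU(3)`
gauge field `U`, every valence mass `m₀` and all reals `E, η` with `g ≤ m₀ − |E|`, the shifted
Hermitian Wilson–Dirac matrix `Γ₅ D_W(U, m₀, 1) − (E + iη)` (tree `hermitianWilsonDirac`) is invertible
and

  `‖(Γ₅ D_W(U,m₀,1) − E − iη)⁻¹ (p, q)‖ ≤ (2/g) · exp(−(min(g,1)/400) · ‖p.1 − q.1‖₁)`

in the periodic taxi distance of the sites (`norm_inv_hermitianWilsonDirac_sub_apply_le_of_gap`) —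
uniformly in the field, the volume, `m₀` and `η ∈ ℝ` (no sign or size condition on `η`).  On the odd tori `2S+1`
with the displacement bookkeeping of route `IntegerCriticalLine` / crux `MobilityGap`
(`‖0 − [v]‖₁ = Σ_i |v_i|` for `|v_i| ≤ S`, `cast_torusDistOne_zero_proj`) this is
`valence_trivialPlateau`; integrated against ANY phase-quenched sea weight `|det D_W(U,x,1)|^{N_f}` and
any Wilson coupling `β` it gives the reweighted fractional-moment quotient bound
`valence_trivialPlateau_fm` — i.e. the valence Aizenman–Molchanov bound negated in the skeleton's
`stub_valencePinch` / `stub_unitaryMatching` HOLDS for valence masses `m₀ ≥ |E| + g` on the trivial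
plateau, whatever the sea mass `x` and the coupling (in particular for `m₀ ∈ [m₁, 1]`, `|E| ≤ m₁/2`:
take `g = m₁/2`).

**Mechanism.**  `Γ₅ D_W − z = Γ₅ · (D_W − z Γ₅)` since `Γ₅² = 1`.  The untwisted factor
`A' = D_W(m₀) − (E+iη)Γ₅` is RANGE ONE with off-site absolute row/column sums `≤ 96` (those of `D_W`:
the twist is site-diagonal; `Literature/…/WilsonDiracRangeOne`) and ACCRETIVE at level `m₀ − |E|`:
Wilson positivity `Re⟨v, D_W(U,m₀,1) v⟩ = m₀‖v‖² + Re⟨v, D_W(U,0,1) v⟩ ≥ m₀ ‖v‖²`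
(`re_form_wilsonDirac_mass`, `re_form_wilsonDirac_zero_nonneg`, landed for this crux's line `Sketch`),
while `⟨v, Γ₅ v⟩ = Σ_i ε_i |v_i|²` is REAL with modulus `≤ ‖v‖²`, so `Re((E+iη)⟨v,Γ₅v⟩) = E⟨v,Γ₅v⟩`
costs at most `|E| ‖v‖²` and `iη` drops out (`re_form_wilsonDirac_sub_smul_gammaFive`; this is the
accretive form of route item `IntegerCriticalLine.TrivialPlateauGap`, `‖Γ₅ D_W(m) v‖ ≥ m ‖v‖`).  The
accretive Combes–Thomas bound `Literature.Analysis.Matrix.accretive_combes_thomas` (`h = 96`,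
`θ = min(g,1)/400`, `96(e^θ − 1) ≤ 192 θ ≤ 0.48 g`) localises `A'⁻¹`, and `(Γ₅ A')⁻¹ = A'⁻¹ Γ₅` has
the entry moduli of `A'⁻¹` (`Γ₅` is the diagonal sign matrix `ε = (1,1,−1,−1)_{spin}`).

References (prose): Combes–Thomas, Comm. Math. Phys. 34 (1973) 251; Aizenman–Warzel, GSM 168, §10.3;
Montvay–Münster §4.2 / §5.1 (Wilson positivity, γ₅-hermiticity).  Pure theorem file (no definitions).
-/

noncomputable section

namespace Summit.QuantumFields.QCD.Theorems.MobilityGapPinch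

open scoped BigOperators Topology ComplexConjugate
open MeasureTheory Filter Set Matrix Complex Finset
open Literature.MathematicalPhysics.QuantumFieldTheory Literature.MathematicalPhysics.QuantumLattice
  Literature.Probability.LatticeModels Literature.Barriers.QuantumFields.WilsonDeterminant
open Summit.QuantumFields.QCD.Theorems.MobilityGapPositiveMass

/-! ### The chirality signs -/

/-- The complex chirality sign `ε_α ∈ (1, 1, -1, -1)` is the cast of the real one. [folklore] -/
private theorem tvp_gammaFiveSign_eq_ofReal (α : Fin 4) :
    (![1, 1, -1, -1] : Fin 4 → ℂ) α = (((![1, 1, -1, -1] : Fin 4 → ℝ) α : ℝ) : ℂ) := by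
  fin_cases α <;> simp

/-- `|ε_α| = 1` for the real chirality sign. [folklore] -/
private theorem tvp_abs_gammaFiveSignReal (α : Fin 4) : |(![1, 1, -1, -1] : Fin 4 → ℝ) α| = 1 := by
  fin_cases α <;> simp

/-- `‖ε_α‖ = 1` for the complex chirality sign. [folklore] -/
private theorem tvp_norm_gammaFiveSign (α : Fin 4) : ‖(![1, 1, -1, -1] : Fin 4 → ℂ) α‖ = 1 := by
  rw [tvp_gammaFiveSign_eq_ofReal, Complex.norm_real, Real.norm_eq_abs, tvp_abs_gammaFiveSignReal]

/-! ### Accretivity of the untwisted operator `D_W(m₀) − (E + iη) Γ₅` -/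

/-- **Accretivity of `D_W(U,m₀,1) − (E+iη) Γ₅` at level `m₀ − |E|`.**  For every `SU(3)` field `U`,
bare mass `m₀`, reals `E, η` and spinor `v`:
`(m₀ − |E|) Σ_i ‖v_i‖² ≤ Re Σ_i conj(v_i) ((D_W(U,m₀,1) − (E+iη)Γ₅) v)_i`.
Wilson positivity gives `Re⟨v, D_W(m₀) v⟩ = m₀‖v‖² + Re⟨v, D_W(0) v⟩ ≥ m₀‖v‖²`
(`re_form_wilsonDirac_mass`, `re_form_wilsonDirac_zero_nonneg`), while `⟨v, Γ₅ v⟩ = Σ_i ε_i |v_i|²`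
is real of modulus `≤ ‖v‖²`, so `Re((E+iη)⟨v, Γ₅ v⟩) = E ⟨v, Γ₅ v⟩ ≤ |E| ‖v‖²`. [folklore] -/
theorem re_form_wilsonDirac_sub_smul_gammaFive {L : ℕ} [NeZero L]
    (U : GaugeConfig 4 L (Matrix.specialUnitaryGroup (Fin 3) ℂ)) (m₀ E η : ℝ)
    (v : TorusSite 4 L × Fin 3 × Fin 4 → ℂ) :
    (m₀ - |E|) * ∑ i, ‖v i‖ ^ 2 ≤
      (∑ i, star (v i) * ((wilsonDirac (fundamentalRep (Fin 3)) U m₀ 1 -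
        ((E : ℂ) + (η : ℂ) * Complex.I) •
          (spinorLift gammaFive :
            Matrix (TorusSite 4 L × Fin 3 × Fin 4) (TorusSite 4 L × Fin 3 × Fin 4) ℂ)) *ᵥ v) i).re := by
  set D := wilsonDirac (fundamentalRep (Fin 3)) U m₀ 1 with hD
  set z : ℂ := (E : ℂ) + (η : ℂ) * Complex.I with hz
  set σ : TorusSite 4 L × Fin 3 × Fin 4 → ℝ := fun p => (![1, 1, -1, -1] : Fin 4 → ℝ) p.2.2 with hσ
  have hΓ : (spinorLift gammaFive :
      Matrix (TorusSite 4 L × Fin 3 × Fin 4) (TorusSite 4 L × Fin 3 × Fin 4) ℂ) =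
        diagonal fun p => ((σ p : ℝ) : ℂ) := by
    rw [spinorLift_gammaFive_eq_diagonal]
    congr 1
    funext p
    exact tvp_gammaFiveSign_eq_ofReal p.2.2
  -- coordinates of `(D − zΓ₅) v`
  have hAv : ∀ i, ((D - z • (spinorLift gammaFive :
      Matrix (TorusSite 4 L × Fin 3 × Fin 4) (TorusSite 4 L × Fin 3 × Fin 4) ℂ)) *ᵥ v) i =
        (D *ᵥ v) i - z * (((σ i : ℝ) : ℂ) * v i) := by
    intro i
    rw [sub_mulVec, smul_mulVec, hΓ, Pi.sub_apply, Pi.smul_apply, mulVec_diagonal, smul_eq_mul]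
  -- the twisted term is `z` times the REAL number `w = Σ ε_i |v_i|²`, `|w| ≤ ‖v‖²`
  set w : ℝ := ∑ i, σ i * ‖v i‖ ^ 2 with hw
  have hterm : ∀ i, star (v i) * (z * (((σ i : ℝ) : ℂ) * v i)) = z * ((σ i * ‖v i‖ ^ 2 : ℝ) : ℂ) := by
    intro i
    have hvv : star (v i) * v i = ((‖v i‖ ^ 2 : ℝ) : ℂ) := by
      rw [Complex.star_def, Complex.conj_mul', Complex.ofReal_pow]
    rw [Complex.ofReal_mul, ← hvv]
    ring
  have hsumz : ∑ i, star (v i) * (z * (((σ i : ℝ) : ℂ) * v i)) = z * (w : ℂ) := by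
    simp only [hterm]
    rw [← Finset.mul_sum, hw, Complex.ofReal_sum]
  have hzre : (z * (w : ℂ)).re = E * w := by
    simp [hz, Complex.mul_re]
  have hwS : |w| ≤ ∑ i, ‖v i‖ ^ 2 := by
    refine (Finset.abs_sum_le_sum_abs _ _).trans (le_of_eq (Finset.sum_congr rfl fun i _ => ?_))
    rw [abs_mul, hσ, tvp_abs_gammaFiveSignReal, one_mul, abs_of_nonneg (by positivity)]
  have hEw : E * w ≤ |E| * ∑ i, ‖v i‖ ^ 2 := by
    have h1 : |E * w| ≤ |E| * ∑ i, ‖v i‖ ^ 2 := by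
      rw [abs_mul]; exact mul_le_mul_of_nonneg_left hwS (abs_nonneg E)
    exact (le_abs_self _).trans h1
  -- Wilson positivity
  have hDre : m₀ * ∑ i, ‖v i‖ ^ 2 ≤ (∑ i, star (v i) * (D *ᵥ v) i).re := by
    have h : (∑ i, star (v i) * (D *ᵥ v) i) = star v ⬝ᵥ (D *ᵥ v) := rfl
    rw [h, hD, re_form_wilsonDirac_mass]
    linarith [re_form_wilsonDirac_zero_nonneg U v]
  -- assemble
  simp only [hAv, mul_sub, Finset.sum_sub_distrib, Complex.sub_re]
  rw [hsumz, hzre]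
  nlinarith [hDre, hEw]

/-! ### Combes–Thomas on the trivial valence plateau, configuration-wise -/

/-- **Deterministic localisation of the valence resolvent on the trivial plateau.**  For every
residual gap `g > 0`, every torus side `L`, every `SU(3)` gauge field `U`, every valence mass `m₀` and
all reals `E, η` with `g ≤ m₀ − |E|`: the shifted Hermitian Wilson–Dirac matrix
`Γ₅ D_W(U,m₀,1) − (E + iη)` is invertible and its colour–spin entries decay in the periodic taxi
distance, `‖(Γ₅ D_W(U,m₀,1) − (E+iη))⁻¹ (p,q)‖ ≤ (2/g) · exp(−(min(g,1)/400) ‖p.1 − q.1‖₁)`, uniformly in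
`U`, `L`, `m₀` and `η ∈ ℝ`.
Proof: `Γ₅ D_W − z = Γ₅ (D_W − z Γ₅)` (`Γ₅² = 1`); the untwisted factor is range one with off-site
row/column sums `≤ 96` (those of `D_W`, the twist being site-diagonal) and `g`-accretive
(`re_form_wilsonDirac_sub_smul_gammaFive`), so the accretive Combes–Thomas bound
(`Literature.Analysis.Matrix.accretive_combes_thomas`, `h = 96`, `θ = min(g,1)/400`,
`96(e^θ − 1) ≤ 192 θ ≤ 0.48 g`) localises its inverse; right multiplication by the diagonal sign
matrix `Γ₅` preserves entry moduli. [folklore] -/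
theorem norm_inv_hermitianWilsonDirac_sub_apply_le_of_gap {g : ℝ} (hg : 0 < g) :
    ∀ (L : ℕ) [NeZero L] (U : GaugeConfig 4 L (Matrix.specialUnitaryGroup (Fin 3) ℂ)) (m₀ E η : ℝ),
      g ≤ m₀ - |E| →
      IsUnit (hermitianWilsonDirac (fundamentalRep (Fin 3)) U m₀ 1 -
          ((E : ℂ) + (η : ℂ) * Complex.I) •
            (1 : Matrix (TorusSite 4 L × Fin 3 × Fin 4) (TorusSite 4 L × Fin 3 × Fin 4) ℂ)).det ∧
      ∀ p q : TorusSite 4 L × Fin 3 × Fin 4,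
        ‖(hermitianWilsonDirac (fundamentalRep (Fin 3)) U m₀ 1 -
            ((E : ℂ) + (η : ℂ) * Complex.I) •
              (1 : Matrix (TorusSite 4 L × Fin 3 × Fin 4) (TorusSite 4 L × Fin 3 × Fin 4) ℂ))⁻¹ p q‖ ≤
          2 / g * Real.exp (-(min g 1 / 400 * (torusTaxiDist p.1 q.1 : ℝ))) := by
  intro L _ U m₀ E η hgap
  set Γ : Matrix (TorusSite 4 L × Fin 3 × Fin 4) (TorusSite 4 L × Fin 3 × Fin 4) ℂ :=
    spinorLift gammaFive with hΓdef
  set D := wilsonDirac (fundamentalRep (Fin 3)) U m₀ 1 with hDdef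
  set z : ℂ := (E : ℂ) + (η : ℂ) * Complex.I with hz
  set A' : Matrix (TorusSite 4 L × Fin 3 × Fin 4) (TorusSite 4 L × Fin 3 × Fin 4) ℂ :=
    D - z • Γ with hA'
  have hρ : ∀ u : Matrix.specialUnitaryGroup (Fin 3) ℂ,
      fundamentalRep (Fin 3) u ∈ Matrix.unitaryGroup (Fin 3) ℂ :=
    fun u => fundamentalRep_mem_unitaryGroup u
  have hΓΓ : Γ * Γ = 1 := spinorLift_gammaFive_mul_self
  set ε : TorusSite 4 L × Fin 3 × Fin 4 → ℂ := fun p => (![1, 1, -1, -1] : Fin 4 → ℂ) p.2.2 with hε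
  have hΓdiag : Γ = diagonal ε := spinorLift_gammaFive_eq_diagonal
  -- the factorisation `Γ₅ D − z = Γ₅ (D − z Γ₅)`
  have hfac : hermitianWilsonDirac (fundamentalRep (Fin 3)) U m₀ 1 -
      z • (1 : Matrix (TorusSite 4 L × Fin 3 × Fin 4) (TorusSite 4 L × Fin 3 × Fin 4) ℂ) = Γ * A' := by
    rw [hA', Matrix.mul_sub, Matrix.mul_smul, hΓΓ]
    rfl
  -- off-site entries of `A'` are entries of `D`
  have hoff : ∀ p q : TorusSite 4 L × Fin 3 × Fin 4, p ≠ q → A' p q = D p q := by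
    intro p q hpq
    rw [hA', Matrix.sub_apply, Matrix.smul_apply, hΓdiag, diagonal_apply_ne _ hpq, smul_zero, sub_zero]
  -- range one in the taxi distance of the sites
  have hrange : ∀ p q : TorusSite 4 L × Fin 3 × Fin 4, A' p q ≠ 0 → torusTaxiDist p.1 q.1 ≤ 1 := by
    intro p q h
    by_cases hpq : p = q
    · rw [hpq, torusTaxiDist_self]; exact zero_le_one
    · rw [hoff p q hpq] at h
      exact torusTaxiDist_le_one_of_wilsonDirac_ne_zero (fundamentalRep (Fin 3)) hρ U m₀ p q h
  -- off-site row and column sums `≤ 96`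
  have hrow : ∀ p, ∑ q ∈ univ.filter (fun q : TorusSite 4 L × Fin 3 × Fin 4 => torusTaxiDist p.1 q.1 ≠ 0),
      ‖A' p q‖ ≤ 96 := by
    intro p
    calc _ = ∑ q ∈ univ.filter (fun q : TorusSite 4 L × Fin 3 × Fin 4 => torusTaxiDist p.1 q.1 ≠ 0),
          ‖D p q‖ := by
          refine Finset.sum_congr rfl fun q hq => ?_
          rw [hoff p q ?_]
          rintro rfl
          exact (Finset.mem_filter.1 hq).2 (torusTaxiDist_self _)
      _ ≤ 32 * (3 : ℕ) := wilsonDirac_rowSum_torusTaxiDist_le (fundamentalRep (Fin 3)) hρ U m₀ p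
      _ = 96 := by norm_num
  have hcol : ∀ q, ∑ p ∈ univ.filter (fun p : TorusSite 4 L × Fin 3 × Fin 4 => torusTaxiDist p.1 q.1 ≠ 0),
      ‖A' p q‖ ≤ 96 := by
    intro q
    calc _ = ∑ p ∈ univ.filter (fun p : TorusSite 4 L × Fin 3 × Fin 4 => torusTaxiDist p.1 q.1 ≠ 0),
          ‖D p q‖ := by
          refine Finset.sum_congr rfl fun p hp => ?_
          rw [hoff p q ?_]
          rintro rfl
          exact (Finset.mem_filter.1 hp).2 (torusTaxiDist_self _)
      _ ≤ 32 * (3 : ℕ) := wilsonDirac_colSum_torusTaxiDist_le (fundamentalRep (Fin 3)) hρ U m₀ q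
      _ = 96 := by norm_num
  -- accretivity at level `g`
  have hacc : ∀ v : TorusSite 4 L × Fin 3 × Fin 4 → ℂ,
      g * ∑ i, ‖v i‖ ^ 2 ≤ (∑ i, star (v i) * (A' *ᵥ v) i).re := by
    intro v
    have h := re_form_wilsonDirac_sub_smul_gammaFive U m₀ E η v
    have hS : 0 ≤ ∑ i, ‖v i‖ ^ 2 := Finset.sum_nonneg fun i _ => by positivity
    exact (mul_le_mul_of_nonneg_right hgap hS).trans h
  -- the rate `θ = min(g,1)/400`: `96 (e^θ − 1) ≤ g / 2`
  have ht0 : 0 < min g 1 := lt_min hg one_pos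
  have ht1 : min g 1 ≤ 1 := min_le_right _ _
  have htg : min g 1 ≤ g := min_le_left _ _
  have hθ0 : (0 : ℝ) ≤ min g 1 / 400 := by positivity
  have hη' : (96 : ℝ) * (Real.exp (min g 1 / 400) - 1) ≤ g / 2 := by
    have h1 := Real.abs_exp_sub_one_le (x := min g 1 / 400) (by rw [abs_of_nonneg hθ0]; linarith)
    rw [abs_of_nonneg hθ0, abs_of_nonneg (by linarith [Real.add_one_le_exp (min g 1 / 400 : ℝ)])] at h1
    linarith
  obtain ⟨hdet, hB⟩ := Literature.Analysis.Matrix.accretive_combes_thomas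
    (fun p q : TorusSite 4 L × Fin 3 × Fin 4 => torusTaxiDist p.1 q.1)
    (fun p => torusTaxiDist_self p.1) (fun p q => torusTaxiDist_comm p.1 q.1)
    (fun p q r => torusDistOne_triangle (Ls := fun _ : Fin 4 => L) p.1 q.1 r.1)
    A' hrange 96 hrow hcol g (min g 1 / 400) hg hθ0 hacc hη'
  -- back to `Γ₅ D − z = Γ₅ A'`: `det Γ₅ = 1`, `(Γ₅ A')⁻¹ = A'⁻¹ Γ₅`, `|ε_q| = 1`
  refine ⟨?_, fun p q => ?_⟩
  · rw [hfac, det_mul, hΓdef, det_spinorLift_gammaFive, one_mul]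
    exact hdet
  · rw [hfac, Matrix.mul_inv_rev, Matrix.inv_eq_left_inv hΓΓ, hΓdiag, mul_diagonal, norm_mul, hε,
      tvp_norm_gammaFiveSign, mul_one]
    exact hB p q

/-! ### The route-shaped statements on the odd tori `2S+1` -/

/-- **The trivial valence plateau (deterministic, sea-uniform).**  For every residual gap `g > 0`
there are `C, c > 0` (`C = 2/g`, `c = min(g,1)/400`) such that for EVERY torus of side `2S+1`, EVERY
`SU(3)` gauge field `U`, every valence mass `m₀` and energy `E` with `g ≤ m₀ − |E|`, every real `η`,
every displacement `v ∈ ℤ⁴` with `|v_i| ≤ S` and all colour/spin indices,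
`‖(Γ₅ D_W(U,m₀,1) − E − iη)⁻¹ ((0,a,α),([v],b,γ))‖ ≤ C · exp(−c Σ_i |v_i|)`
(for the plateau `m₀ ∈ [m₁, ∞)`, `|E| ≤ m₁/2` take `g = m₁/2`).  The pathwise — hence disorder- and
sea-independent — localisation of the valence Hermitian Wilson–Dirac kernel on the trivial plateau
`m₀ > 0`: the accretive content of route item `IntegerCriticalLine.TrivialPlateauGap` fed into
Combes–Thomas, with the odd-torus bookkeeping `‖0 − [v]‖₁ = Σ|v_i|` (`cast_torusDistOne_zero_proj`).
[folklore] -/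
theorem valence_trivialPlateau : ∀ g : ℝ, 0 < g → ∃ C c : ℝ, 0 < C ∧ 0 < c ∧ ∀ (S : ℕ) (U : GaugeConfig 4 (2 * S + 1) (Matrix.specialUnitaryGroup (Fin 3) ℂ)) (m₀ E η : ℝ), g ≤ m₀ - |E| → ∀ v : Fin 4 → ℤ, (∀ i, |v i| ≤ S) → ∀ (a b : Fin 3) (α γ : Fin 4), ‖(hermitianWilsonDirac (fundamentalRep (Fin 3)) U m₀ 1 - ((E : ℂ) + (η : ℂ) * Complex.I) • (1 : Matrix (TorusSite 4 (2 * S + 1) × Fin 3 × Fin 4) (TorusSite 4 (2 * S + 1) × Fin 3 × Fin 4) ℂ))⁻¹ ((0 : TorusSite 4 (2 * S + 1)), a, α) (Torus.proj (2 * S + 1) v, b, γ)‖ ≤ C * Real.exp (-(c * ∑ i, |(v i : ℝ)|)) := by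
  intro g hg
  refine ⟨2 / g, min g 1 / 400, by positivity, div_pos (lt_min hg one_pos) (by norm_num), ?_⟩
  intro S U m₀ E η hgap v hv a b α γ
  have h := (norm_inv_hermitianWilsonDirac_sub_apply_le_of_gap hg (2 * S + 1) U m₀ E η hgap).2
    ((0 : TorusSite 4 (2 * S + 1)), a, α) (Torus.proj (2 * S + 1) v, b, γ)
  have hd : ((torusTaxiDist (0 : TorusSite 4 (2 * S + 1)) (Torus.proj (2 * S + 1) v) : ℕ) : ℝ) =
      ∑ i, |(v i : ℝ)| :=
    cast_torusDistOne_zero_proj S v hv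
  rw [hd] at h
  exact h

/-- **The trivial valence plateau in fractional-moment currency, under any phase-quenched sea.**  For
every residual gap `g > 0` and every exponent `s > 0` there are `C, c > 0` such that for every flavour
number `N_f`, every Wilson coupling `β`, every sea mass `x`, every torus `2S+1`, every valence mass
`m₀` and energy `E` with `g ≤ m₀ − |E|`, every real `η`, every `v` with `|v_i| ≤ S` and all indices,
the `|det D_W(U,x,1)|^{N_f}`-reweighted Wilson-measure `s`-moment quotient of the valence resolvent
entry `(Γ₅ D_W(U,m₀,1) − E − iη)⁻¹((0,a,α),([v],b,γ))` is `≤ C · exp(−c Σ_i |v_i|)`: the reweighted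
valence Aizenman–Molchanov bound of crux `MobilityGap`'s line `Ideator6Sketch` HOLDS on the trivial
plateau whatever the sea and the coupling (the pathwise bound of `valence_trivialPlateau` integrates
against the non-negative continuous weight; a vanishing normalisation makes the quotient `0`).
[folklore] -/
theorem valence_trivialPlateau_fm : ∀ g s : ℝ, 0 < g → 0 < s → ∃ C c : ℝ, 0 < C ∧ 0 < c ∧ ∀ (Nf : ℕ) (β x : ℝ) (S : ℕ) (m₀ E η : ℝ), g ≤ m₀ - |E| → ∀ v : Fin 4 → ℤ, (∀ i, |v i| ≤ S) → ∀ (a b : Fin 3) (α γ : Fin 4), (∫ U : GaugeConfig 4 (2 * S + 1) (Matrix.specialUnitaryGroup (Fin 3) ℂ), ‖fermionDet (wilsonDirac (fundamentalRep (Fin 3)) U x 1)‖ ^ Nf * ‖(hermitianWilsonDirac (fundamentalRep (Fin 3)) U m₀ 1 - ((E : ℂ) + (η : ℂ) * Complex.I) • (1 : Matrix (TorusSite 4 (2 * S + 1) × Fin 3 × Fin 4) (TorusSite 4 (2 * S + 1) × Fin 3 × Fin 4) ℂ))⁻¹ ((0 : TorusSite 4 (2 * S + 1)), a, α) (Torus.proj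 (2 * S + 1) v, b, γ)‖ ^ s ∂(wilsonMeasure (d := 4) (L := 2 * S + 1) (fundamentalRep (Fin 3)) β)) / (∫ U : GaugeConfig 4 (2 * S + 1) (Matrix.specialUnitaryGroup (Fin 3) ℂ), ‖fermionDet (wilsonDirac (fundamentalRep (Fin 3)) U x 1)‖ ^ Nf ∂(wilsonMeasure (d := 4) (L := 2 * S + 1) (fundamentalRep (Fin 3)) β)) ≤ C * Real.exp (-(c * ∑ i, |(v i : ℝ)|)) := by
  intro g s hg hs
  obtain ⟨C, c, hC, hc, hdec⟩ := valence_trivialPlateau g hg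
  refine ⟨C ^ s, c * s, Real.rpow_pos_of_pos hC s, mul_pos hc hs, ?_⟩
  intro Nf β x S m₀ E η hgap v hv a b α γ
  -- notation: the measure, the weight, the entry modulus, the pathwise bound
  set μW : Measure (GaugeConfig 4 (2 * S + 1) (Matrix.specialUnitaryGroup (Fin 3) ℂ)) :=
    wilsonMeasure (d := 4) (L := 2 * S + 1) (fundamentalRep (Fin 3)) β with hμW
  set w : GaugeConfig 4 (2 * S + 1) (Matrix.specialUnitaryGroup (Fin 3) ℂ) → ℝ :=
    fun U => ‖fermionDet (wilsonDirac (fundamentalRep (Fin 3)) U x 1)‖ ^ Nf with hw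
  set X : GaugeConfig 4 (2 * S + 1) (Matrix.specialUnitaryGroup (Fin 3) ℂ) → ℝ :=
    fun U => ‖(hermitianWilsonDirac (fundamentalRep (Fin 3)) U m₀ 1 - ((E : ℂ) + (η : ℂ) * Complex.I) •
      (1 : Matrix (TorusSite 4 (2 * S + 1) × Fin 3 × Fin 4) (TorusSite 4 (2 * S + 1) × Fin 3 × Fin 4) ℂ))⁻¹
        ((0 : TorusSite 4 (2 * S + 1)), a, α) (Torus.proj (2 * S + 1) v, b, γ)‖ with hX
  set B : ℝ := C * Real.exp (-(c * ∑ i, |(v i : ℝ)|)) with hB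
  have hB0 : 0 < B := by positivity
  have hXB : ∀ U, X U ≤ B := fun U => hdec S U m₀ E η hgap v hv a b α γ
  have hX0 : ∀ U, 0 ≤ X U := fun U => norm_nonneg _
  have hw0 : ∀ U, 0 ≤ w U := fun U => by positivity
  -- `B^s` is the claimed right-hand side
  have hBs : B ^ s = C ^ s * Real.exp (-(c * s * ∑ i, |(v i : ℝ)|)) := by
    rw [hB, Real.mul_rpow hC.le (Real.exp_pos _).le, ← Real.exp_mul]
    congr 2
    ring
  rw [← hBs]
  -- the weight is integrable (continuous on a compact space, finite measure)
  have hwc : Continuous w :=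
    ((continuous_wilsonDirac (fundamentalRep (Fin 3)) (continuous_fundamentalRep (Fin 3)) x
      1).matrix_det.norm.pow Nf)
  obtain ⟨K, hK⟩ : ∃ K : ℝ, ∀ U, w U ≤ K := by
    obtain ⟨U₀, -, hU₀⟩ := (isCompact_univ (X := GaugeConfig 4 (2 * S + 1)
      (Matrix.specialUnitaryGroup (Fin 3) ℂ))).exists_isMaxOn Set.univ_nonempty hwc.continuousOn
    exact ⟨w U₀, fun U => hU₀ (Set.mem_univ U)⟩
  have hwi : Integrable w μW :=
    Integrable.of_bound hwc.measurable.aestronglyMeasurable K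
      (Eventually.of_forall fun U => by rw [Real.norm_eq_abs, abs_of_nonneg (hw0 U)]; exact hK U)
  -- pointwise and integrated comparison
  have hpt : ∀ U, w U * X U ^ s ≤ w U * B ^ s := fun U =>
    mul_le_mul_of_nonneg_left (Real.rpow_le_rpow (hX0 U) (hXB U) hs.le) (hw0 U)
  have hnum : ∫ U, w U * X U ^ s ∂μW ≤ (∫ U, w U ∂μW) * B ^ s := by
    rw [← integral_mul_const]
    exact integral_mono_of_nonneg (Eventually.of_forall fun U =>
        mul_nonneg (hw0 U) (Real.rpow_nonneg (hX0 U) _))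
      (hwi.mul_const _) (Eventually.of_forall hpt)
  have hZ0 : 0 ≤ ∫ U, w U ∂μW := integral_nonneg hw0
  have hBs0 : 0 ≤ B ^ s := Real.rpow_nonneg hB0.le _
  show (∫ U, w U * X U ^ s ∂μW) / (∫ U, w U ∂μW) ≤ B ^ s
  rcases hZ0.eq_or_lt with hZ | hZ
  · rw [← hZ, div_zero]
    exact hBs0
  · rw [div_le_iff₀ hZ]
    exact hnum.trans_eq (mul_comm _ _)

end Summit.QuantumFields.QCD.Theorems.MobilityGapPinch

end
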